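import Summits.BirchSwinnertonDyer.BirchSwinnertonDyer.Theorems.QuadraticBranchSignedControlPlusEtaLowerInclusionRankZeroPairs
import Summits.BirchSwinnertonDyer.Rank1Residual.Additive.QuadraticBranchEvenExactControlDischarge
import Summits.BirchSwinnertonDyer.Rank1Residual.Additive.QuadraticBranchTamagawaAtOddPrime
import HarnessLib

/-!
# Route `QuadraticBranchSignedControl` (rung K8, cell `bsd-potss`), crux `PlusEtaLowerInclusion`
# (item stmt-BirchSwinnertonDyer-19601): the TAMAGAWA-DEFECT rows — (E⁺_η) at a tower-onto Gss2 pair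
# of analytic rank zero from the FULL lower `p`-part of BSD for `W` (`v_p(L(W,1)/Ω_W) ≤ ord_p #Ш(W)(p)
# + ord_p Tam(W)`), granted Poitou–Tate duality (sequel of `…PlusEtaLowerInclusionRankZeroPairs`)

WHAT. The sibling file proves (E⁺_η)(V, p) on a tower-onto rank-zero Gss2 pair `(V, W)` from the
witness «`v_p(L(W,1)/Ω_W) ≤ ord_p #Sel_{p^∞}(W/ℚ)`» — the UNIT-TAMAGAWA rows (`p ∤ Tam(W)`, e.g. the
BC5 rung `39675m1`). THIS FILE removes that restriction: with the Poitou–Tate duality for Selmer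
structures (NAMED fact `poitouTate_selmerStructure_duality_real ℚ`, Milne ADT I.4.10, as in ctrl's
T-e2-r0) the defect of the bottom-layer control is COUNTED (ctrl's
`RankZeroCount.card_localPreimage_one_eq_card_selmer_mul_prod_…`: `#A₀⁺ = #Sel · ∏_ℓ p^{ord_p c_ℓ(W)}`),
so for a characteristic power series `g` of ANY `η`-datum `D` of `V`:
* §1 **B. D. Kim's Euler-characteristic formula at `η`, algebraic side** —
  `v_p(g(0)) = ord_p #Sel_{p^∞}(W/ℚ) + ord_p Tam(W)` whenever `g(0) ≠ 0`
  (`valuation_constantCoeff_charGenerator_eq_of_namedFacts_of_poitouTate`; Thm. 2.2 at `η`,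
  Kitajima–Otsuki, Poitou–Tate; the twin of ctrl's `quadraticBranchEvenExactControlOfPlusMCAt_of_readings`
  with the main conjecture REMOVED — it is about `Char(X⁺(V/K_∞)^η)` itself, not about `L_p⁺(V,η,X)`);
* §2 **(E⁺_η) from the FULL lower `p`-part of BSD for `W`** —
  `quadraticBranchPlusEtaLowerInclusionAt_of_namedFacts_of_poitouTate_of_bsdLowerWitness` (witness
  «`L(W,1)/Ω_W = q`, `v_p(q) ≤ ord_p #Sel_{p^∞}(W/ℚ) + ord_p Tam(W)`») and its `Ш`-shape with GZK
  («`v_p(q) ≤ ord_p #Ш(W)(p) + ord_p Tam(W)`», = Kim's Thm. 1.8 (6) output `ord_p q₀ − j ≤ ord_p #Ш(p)`,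
  `j ≤ ord_p ∏ c_ℓ`, the socket shape of additive-p4's `X4RankZeroKuriharaWitness`).
READING: on the tower-onto rows with `r_an(W) = 0`, crux 19601 ⟸ the lower half of `BSD(W, p)`
(`ord_p #Ш(W)_an ≤ ord_p #Ш(W)`; `p ∤ #W(ℚ)_tors` automatically) — the exact converse of ctrl's T-e2-r0;
together: on these rows (E⁺_η)(V,p) ⟺ (C1⁺_η)(V,p) ⟺ `BSD(W,p)` modulo the named facts.

HONEST FRAMING (cell `bsd-potss`, run/shared/lean/pub/bsd-potss/; FULL-BSD rank ≤ 1 programme,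
HUMAN RULING D-0036/D-0074/D-0088(2)): TOOL THEOREMS ONLY, CONDITIONAL on named Literature facts in
hypothesis position (Kobayashi 2003 Thm. 2.2 / 4.1 at `η`, Kitajima–Otsuki 2018 Thm. 1.3, Poitou–Tate
(Milne I.4.10), modularity, GZK) and on DISPLAYED per-pair inputs (`L(W,1) ≠ 0`, the lower witness).
Crux 19601 is NOT closed; nothing is booked; no label / mark / count moves; `BSD(W, p)` is claimed for
no pair; no definition, no named fact minted, no `sorry`, axioms standard. Seat `bsd-potss-k8-rung`
(prover), g0; `--supports stmt-BirchSwinnertonDyer-19601 --as helper`.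

References: [Kobayashi2003] Thm. 2.2 (p. 5), (3.6) (p. 7), §4 + Thm. 4.1 (p. 8), Thm. 9.3 with (9.33)
(pp. 26–27); [KitajimaOtsuki2018] Main Thm. 1.3; [MilneADT2006] I Thm. 4.10; [GreenbergLNM1716] §3
Lemma 3.1–3.3, §4 Lemma 4.2 (p. 102); [BDKim2013] Thm. 1.1 (shape); [Kim2022StructureSelmer] Thm. 1.9
(6) (PDF pp. 7–8).
-/

set_option autoImplicit false
set_option linter.dupNamespace false

noncomputable section

open scoped Classical

open CongruenceSubgroup Field NumberField IsDedekindDomain WeierstrassCurve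
open Literature.NumberTheory.EllipticCurves
open Literature.NumberTheory.EllipticCurves.ModularForms
open Literature.NumberTheory.GaloisRepresentations
open Literature.NumberTheory.GaloisCohomology
open Literature.NumberTheory.EllipticCurves.IwasawaDual
open Summit.BirchSwinnertonDyer.Rank1Residual.Additive
open Summit.BirchSwinnertonDyer.Rank1Residual.Additive.SignedTwist
open Summit.BirchSwinnertonDyer.Rank1Residual.AdditivePotMult

namespace Summit.BirchSwinnertonDyer.BirchSwinnertonDyer.Theorems

variable {V : WeierstrassCurve ℚ} [V.IsElliptic] [V.IsGloballyMinimal] {p : ℕ} [hp : Fact p.Prime]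

/-! ## §1 B. D. Kim's Euler-characteristic formula at `η` for the characteristic power series -/

/-- **`v_p(g(0)) = ord_p #Sel_{p^∞}(W/ℚ) + ord_p Tam(W)` for a characteristic power series `g` of
`X⁺(V/K_∞)^η` with `g(0) ≠ 0`** — the algebraic side of B. D. Kim's formula at `η`, for the
`p*`-partner `W` of a good `a_p = 0` curve `V` (`p` odd), ANY `η`-datum `D` at a topological generator
`γ ∈ Gal(ℚ̄/K₀)` of the cyclotomic `κ`: Thm. 2.2 at `η` (`h22`) and Kitajima–Otsuki (`hKO`) for the
transported `W`-datum, ctrl's exact bottom-layer count `#Sel^{loc,∞,+}(W/ℚ) = p^{v_p g(0)}` and, under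
Poitou–Tate (`hPT`), `#Sel^{loc,∞,+}(W/ℚ) = #Sel_{p^∞}(W/ℚ) · ∏_ℓ p^{ord_p c_ℓ(W)}` (`ord_p c_p(W) = 0`
at every odd `p`). Also `Sel_{p^∞}(W/ℚ)` is finite. CONDITIONAL on the three named facts; no main
conjecture is used. [cite: Kobayashi2003, Thm. 2.2 (p. 5), Thm. 9.3 with (9.33) (pp. 26–27)]
[cite: KitajimaOtsuki2018, Main Thm. 1.3] [cite: MilneADT2006, Ch. I, Thm. 4.10] [cite: BDKim2013, Thm. 1.1 (shape)] -/
theorem valuation_constantCoeff_charGenerator_eq_of_namedFacts_of_poitouTate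
    (h22 : Kobayashi2003.thm22_etaSignedSelmerDual_finite_torsion)
    (hKO : KitajimaOtsuki2018.mainThm13_etaSignedSelmerDual_noFiniteSubmodule)
    (hPT : poitouTate_selmerStructure_duality_real ℚ)
    (W : WeierstrassCurve ℚ) [W.IsElliptic] [W.IsGloballyMinimal] (C : VariableChange ℚ)
    (hp2 : p ≠ 2) (hCV : C • W.quadraticTwist ((-1) ^ (p / 2) * p) = V)
    (hgood : V.HasGoodReductionAtPrime p) (hap : V.frobeniusTrace p = 0)
    {K₀ : Type} [Field K₀] [NumberField K₀] [IsCyclotomicExtension {p} ℚ K₀]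
    [(galRange (K := ℚ) K₀).Normal] {ηq : absoluteGaloisGroup ℚ →* ℤˣ}
    (hηK : ∀ σ ∈ galRange (K := ℚ) K₀, ηq σ = 1) (hη1 : ηq ≠ 1)
    {κ : ZpExtension ℚ p} {γ : absoluteGaloisGroup ℚ} (hκ : κ.IsCyclotomic) (hγ : κ.IsTopGenerator γ)
    (hγK : γ ∈ galRange (K := ℚ) K₀) (D : EtaSignedSelmerDualData V κ K₀ ℚ_[p] ηq γ 1)
    {g : IwasawaAlgebra p} (hg : D.charIdeal = Ideal.span {g}) (hg0 : PowerSeries.constantCoeff g ≠ 0) :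
    Finite ↥(W.selmerGroupPInfty p) ∧
      ((PowerSeries.constantCoeff g : ℤ_[p]) : ℚ_[p]).valuation =
        (padicValNat p (Nat.card ↥(W.selmerGroupPInfty p)) : ℤ) + padicValNat p W.tamagawaProduct := by
  -- a `W`-coordinate plus dual datum and its transport to an `η`-datum at `γ`
  obtain ⟨DW⟩ := nonempty_strictSignedSelmerDualData W κ ℚ_[p] 1 hγ
  obtain ⟨θ₀, hθ₀2⟩ := exists_sq_eq_pStar p K₀ hp2
  have hc₀ : θ₀ ^ 2 = algebraMap ℚ K₀ ((-1) ^ (p / 2) * p) := by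
    rw [hθ₀2, map_mul, map_pow, map_neg, map_one, map_natCast]
  have hθ₀ : θ₀ ∉ Set.range (algebraMap ℚ K₀) := by
    rintro ⟨r, hr⟩
    apply forall_sq_ne_pStar p r
    apply (algebraMap ℚ K₀).injective
    rw [map_pow, hr, hc₀]
  have hη : ∀ σ, ηq σ = 1 ↔ σ • rootInClosure K₀ θ₀ = rootInClosure K₀ θ₀ :=
    eta_eq_one_iff_smul_rootInClosure p K₀ hθ₀ hc₀ ηq hηK hη1
  have hDK := localTowerHyp_padic p κ K₀ hκ
  have hκ₀ : ∀ x, ∃ g ∈ galRange (K := ℚ) K₀, κ g = x := kappa_surjOn_galRange_cyclotomic κ K₀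
  have hcop : (galRange (K := ℚ) K₀).index.Coprime p := coprime_index_galRange_cyclotomic p K₀
  have hγγ : γ⁻¹ * γ ∈ κ.kerSubgroup := by rw [inv_mul_cancel]; exact one_mem _
  obtain ⟨D', hfin', htor', hchar', hnf'⟩ :=
    exists_etaSignedSelmerDualData_one W K₀ hθ₀ hc₀ p κ hCV ηq hη ℚ_[p] hDK hκ₀ hcop hγK hγγ DW
  obtain ⟨hfinD', htorD'⟩ :=
    EtaSignedSelmerDualData.finite_isTorsion_of_thm22 h22 hηK hp2 hgood hap hκ hγ hγK D'
  haveI : Module.Finite (IwasawaAlgebra p) DW.X := hfin'.mp hfinD'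
  have htorW : Module.IsTorsion (IwasawaAlgebra p) DW.X := htor'.mp htorD'
  have hnfW : ∀ M : Submodule (IwasawaAlgebra p) DW.X, Finite M → M = ⊥ :=
    hnf'.mp (hKO p K₀ ηq hηK V hp2 hgood hap κ γ hκ hγ hγK 1 D'.toLiterature hfinD' htorD')
  -- uniqueness: `Char(DW.X) = Char(D'.X) = Char(D.X) = (g)`
  obtain ⟨e, -⟩ := isDualPair_exists_linearEquiv
    (EtaSignedSelmerDualData.isDualPair V κ K₀ ℚ_[p] ηq 1 D hκ₀ hγ hγK)
    (EtaSignedSelmerDualData.isDualPair V κ K₀ ℚ_[p] ηq 1 D' hκ₀ hγ hγK)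
  have hcharW : DW.charIdeal = Ideal.span {g} := by
    rw [← hchar', ← hg]
    exact (Module.charIdeal_eq_of_linearEquiv e).symm
  -- ctrl's exact count `#A₀⁺ = p^{v_p g(0)}`
  obtain ⟨hfinSel, -, -, hA⟩ :=
    EvenControlZero.finite_and_padicValNat_card_selmerGroupPInfty_add_eq_of_quadraticTwist_signedPrime W
      κ hp2 C V hCV hgood hap hγ DW htorW hnfW hcharW hg0
  haveI hfinA := Nat.finite_of_card_ne_zero (ne_of_eq_of_ne hA (pow_ne_zero _ hp.out.ne_zero))
  -- the exceptional set `T` = the bad places `≠ v₀`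
  set v₀ := (Rat.HeightOneSpectrum.primesEquiv (R := 𝓞 ℚ)).symm ⟨p, hp.out⟩ with hv₀
  obtain ⟨S, hS⟩ := exists_finset_forall_not_mem_good W p
  set T := S.filter (fun v ↦ (p : 𝓞 ℚ) ∉ v.asIdeal) with hT
  have hv₀p : (p : 𝓞 ℚ) ∈ v₀.asIdeal := (natCast_mem_asIdeal_iff_eq_primesEquiv_symm v₀ hp.out).mpr rfl
  have hpT : v₀ ∉ T := fun h ↦ (Finset.mem_filter.mp h).2 hv₀p
  have hTmem : ∀ v : HeightOneSpectrum (𝓞 ℚ), v ≠ v₀ →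
      p ∣ (W.baseChange (v.adicCompletion ℚ)).localTamagawaNumber (v.adicCompletionIntegers ℚ) →
        v ∈ T := by
    intro v hv hdvd
    refine Finset.mem_filter.mpr ⟨?_, fun hpv ↦
      hv ((natCast_mem_asIdeal_iff_eq_primesEquiv_symm v hp.out).mp hpv)⟩
    by_contra hvS
    rw [W.localTamagawaNumber_eq_one_of_hasGoodReductionAt_holds v (hS v hvS).2] at hdvd
    exact hp.out.one_lt.ne' (Nat.dvd_one.mp hdvd)
  -- Poitou–Tate: `#A₀⁺ = #Sel · ∏_T p^{ord c_ℓ}`; `∑_T ord c_ℓ = ord_p Tam(W)`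
  have hcard := RankZeroCount.card_localPreimage_one_eq_card_selmer_mul_prod_of_quadraticTwist_signedPrime
    κ W hp2 hκ C V hCV hgood hap hPT T hpT hTmem
  have hc0 := padicValNat_localTamagawaNumber_eq_zero_of_quadraticTwist_signedPrime_of_odd W p hp2 C V
    hCV hgood
  have hTamSum := LevelBridge.sum_padicValNat_localTamagawaNumber_eq_padicValNat_tamagawaProduct W p T
    hpT hTmem hc0
  refine ⟨hfinSel, ?_⟩
  haveI := hfinSel
  have hSel0 : Nat.card ↥(W.selmerGroupPInfty p) ≠ 0 := Nat.card_pos.ne'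
  have hp0 : p ≠ 0 := hp.out.ne_zero
  rw [hA, Finset.prod_pow_eq_pow_sum, hTamSum] at hcard
  have hval := congrArg (padicValNat p) hcard
  rw [padicValNat.prime_pow, padicValNat.mul hSel0 (pow_ne_zero _ hp0), padicValNat.prime_pow] at hval
  have hv' : ((PowerSeries.constantCoeff g : ℤ_[p]) : ℚ_[p]).valuation =
      ((((PowerSeries.constantCoeff g : ℤ_[p]) : ℚ_[p]).valuation).toNat : ℤ) :=
    (Int.toNat_of_nonneg (PadicInt.valuation_coe_nonneg)).symm
  rw [hv', hval]
  push_cast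
  ring

/-! ## §2 (E⁺_η) from the full lower `p`-part of BSD for `W` -/

/-- **(E⁺_η) at a tower-onto rank-zero pair from the FULL lower `p`-part of BSD for `W` (Selmer +
Tamagawa shape).** As the sibling's `…_of_namedFacts_of_selmerWitness`, plus Poitou–Tate (`hPT`), with
the witness weakened to «`L(W,1)/Ω_W = q`, `v_p(q) ≤ ord_p #Sel_{p^∞}(W/ℚ) + ord_p Tam(W)`». Chain:
Kato side `g ∣ Lη` (Thm. 4.1 / 2.2 at `η`), value identity `v_p(Lη(0)) = v_p(q)`, §1
`v_p(g(0)) = ord_p #Sel + ord_p Tam`, and the `Λ`-lemma. CONDITIONAL; closes nothing class-wide.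
[cite: Kobayashi2003, (3.6) (p. 7), §4 + Thm. 4.1 (p. 8), Thm. 9.3 (p. 26)] [cite: MilneADT2006, Ch. I, Thm. 4.10] -/
theorem quadraticBranchPlusEtaLowerInclusionAt_of_namedFacts_of_poitouTate_of_bsdLowerWitness
    (h22 : Kobayashi2003.thm22_etaSignedSelmerDual_finite_torsion)
    (h41 : Kobayashi2003.thm41_plusEtaCharIdeal_dvd)
    (hKO : KitajimaOtsuki2018.mainThm13_etaSignedSelmerDual_noFiniteSubmodule)
    (hmod : hasEntireLFunction_rat) (hPT : poitouTate_selmerStructure_duality_real ℚ)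
    (W : WeierstrassCurve ℚ) [W.IsElliptic] [W.IsGloballyMinimal] (C : VariableChange ℚ)
    (hCV : C • W.quadraticTwist ((-1) ^ (p / 2) * p) = V)
    (hsurj : ∀ m : ℕ, V.HasSurjectiveModNGaloisRep (p ^ m : ℕ))
    (hLW : W.entireLFunction 1 ≠ 0)
    (hwit : ∃ q : ℚ, W.entireLFunction 1 / (W.realPeriodRat : ℂ) = (q : ℂ) ∧
      padicValRat p q ≤ (padicValNat p (Nat.card ↥(W.selmerGroupPInfty p)) : ℤ) +
        padicValNat p W.tamagawaProduct) :
    QuadraticBranchPlusEtaLowerInclusionAt V p := by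
  intro K₀ _ _ _ _ ηq hηK hη1 N _ f hp2 hgood hap hf ϖ hϖ Lη hL κ γ hκ hγ hγK hγc D
  -- Thm. 2.2 at `η`; a characteristic power series `g`; the Kato side `g ∣ Lη`
  obtain ⟨hfin, -⟩ :=
    EtaSignedSelmerDualData.finite_isTorsion_of_thm22 h22 hηK hp2 hgood hap hκ hγ hγK D
  haveI : Module.Finite (IwasawaAlgebra p) D.X := hfin
  obtain ⟨g, hg⟩ := (charIdeal_isPrincipal_holds p D.X).principal
  have hg' : D.charIdeal = Ideal.span {g} := hg
  obtain ⟨-, hup⟩ := EtaSignedSelmerDualData.thm41_plus_of_facts h22 h41 hηK hη1 hp2 hgood hap hf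
    ϖ hϖ Lη hL hκ hγ hγK hγc D
  have hgL : g ∣ Lη := by
    have h := hup hsurj
    rw [hg', Ideal.span_singleton_le_span_singleton] at h
    exact h
  -- the value identity
  obtain ⟨q, hq, hqle⟩ := hwit
  obtain ⟨hval, hne⟩ :=
    valuation_constantCoeff_eq_padicValRat_of_twist p hmod hp2 W V C hCV hgood hf hϖ hL hq
  have hL0 : PowerSeries.constantCoeff Lη ≠ 0 := hne hLW
  have hg0 : PowerSeries.constantCoeff g ≠ 0 := by
    obtain ⟨h, hh⟩ := hgL
    intro h0
    apply hL0
    rw [hh, map_mul, h0, zero_mul]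
  -- §1 and the squeeze
  obtain ⟨-, hEuler⟩ := valuation_constantCoeff_charGenerator_eq_of_namedFacts_of_poitouTate h22 hKO hPT
    W C hp2 hCV hgood hap hηK hη1 hκ hγ hγK D hg' hg0
  have hle : ((PowerSeries.constantCoeff Lη : ℤ_[p]) : ℚ_[p]).valuation ≤
      ((PowerSeries.constantCoeff g : ℤ_[p]) : ℚ_[p]).valuation := by
    rw [hval, hEuler]
    exact hqle
  rw [hg', span_singleton_eq_of_dvd_of_valuation_le hgL hL0 hle]

/-- **(E⁺_η) at a tower-onto rank-zero pair from the lower half of `BSD(W, p)` in Kim's output shape**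
— witness «`L(W,1)/Ω_W = q`, `v_p(q) ≤ ord_p #Ш(W)(p) + ord_p Tam(W)`» (Kim 2026 Thm. 1.8 (6):
`ord_p q − j ≤ ord_p #Ш(p)`, `j ≤ ord_p ∏ c_ℓ`), plus GZK (rank `0`: `#Sel_{p^∞} = #Ш[p^∞]`) and
Poitou–Tate. CONDITIONAL; closes nothing class-wide.
[cite: Kim2022StructureSelmer, Thm. 1.9 (6) (PDF pp. 7–8), §1.5.1] [cite: Kobayashi2003, §4 + Thm. 4.1 (p. 8), Thm. 9.3 (p. 26)] -/
theorem quadraticBranchPlusEtaLowerInclusionAt_of_namedFacts_of_poitouTate_of_shaTamagawaWitness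
    (h22 : Kobayashi2003.thm22_etaSignedSelmerDual_finite_torsion)
    (h41 : Kobayashi2003.thm41_plusEtaCharIdeal_dvd)
    (hKO : KitajimaOtsuki2018.mainThm13_etaSignedSelmerDual_noFiniteSubmodule)
    (hmod : hasEntireLFunction_rat) (hPT : poitouTate_selmerStructure_duality_real ℚ)
    (hGZK : rank_eq_analyticRank_of_analyticRank_le_one)
    (W : WeierstrassCurve ℚ) [W.IsElliptic] [W.IsGloballyMinimal] (C : VariableChange ℚ)
    (hCV : C • W.quadraticTwist ((-1) ^ (p / 2) * p) = V)
    (hsurj : ∀ m : ℕ, V.HasSurjectiveModNGaloisRep (p ^ m : ℕ))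
    (hLW : W.entireLFunction 1 ≠ 0)
    (hwit : ∃ q : ℚ, W.entireLFunction 1 / (W.realPeriodRat : ℂ) = (q : ℂ) ∧
      padicValRat p q ≤ (padicValNat p (Nat.card (AddCommGroup.primaryComponent W.sha p)) : ℤ) +
        padicValNat p W.tamagawaProduct) :
    QuadraticBranchPlusEtaLowerInclusionAt V p := by
  obtain ⟨q, hq, hqle⟩ := hwit
  obtain ⟨-, hE, -, -⟩ := Wuthrich2014.shaAn_eq_of_L_one_div_eq hGZK W hLW hq
  haveI := hE
  refine quadraticBranchPlusEtaLowerInclusionAt_of_namedFacts_of_poitouTate_of_bsdLowerWitness h22 h41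
    hKO hmod hPT W C hCV hsurj hLW ⟨q, hq, ?_⟩
  rw [W.natCard_selmerGroupPInfty_eq_natCard_primaryComponent_sha p]
  exact hqle

end Summit.BirchSwinnertonDyer.BirchSwinnertonDyer.Theorems

end
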